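import Literature.NumberTheory.GaloisRepresentations.ContinuousShapiroOpenCoinducedLayerModule
import Literature.Algebra.Homology.DiscreteRepLayerRestriction
import Literature.Algebra.Homology.DiscreteRepStandardResolutionRestriction
import HarnessLib

/-!
# Shapiro READ ON THE LAYERS of `Hⁿ_cont(Γ, Maps(Γ⧸W, M))`: restricting to `W` and evaluating at `1` an
# inflated `Γ`-layer class is inflating (to `W`) the FINITE Shapiro image of the layer class
# (Serre, *Cohomologie galoisienne* I §2.2 Prop. 8, §2.5 Prop. 10; NSW (1.6.4))

Topic `NumberTheory/GaloisRepresentations` (continuous cochain cohomology); namespace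
`Literature.NumberTheory.GaloisRepresentations` (dot notation under `ContinuousRep`).  Definitions with
bodies (the evaluation-at-`1` morphism of the permutation model, the group isomorphism
`W⧸(V∩W) →* W⧸V ≤ Γ⧸V` and the identity-on-vectors layer morphism) and theorems; no named fact, no
`sorry`, no instance, no notation.  Sequel of `ContinuousShapiroOpenCoinducedLayerModule` (the layer
iso `(Maps(Γ⧸W, M))^V ≅ funRep (M^V) ((Γ⧸V)⧸(W⧸V))`) and of door-c4's `DiscreteRepLayerRestriction`
(`extRes_inflG`: restriction to an open subgroup read on layers).

For `Γ` compact, `W ⊴ Γ` open, `V ⊴ Γ` open with `V ≤ W`, `M` a discrete `Γ`-module and `C = Maps(Γ⧸W, M)`: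
at the `Ext`-level of door-c4's colimit theorem, the Shapiro map of the lane
(`Res_W` followed by `ev₁ : C|_W → M|_W`, `φ ↦ φ(1)`) sends the class inflated from a `funRep`-layer
class `y ∈ Hⁿ(Γ⧸V, Maps((Γ⧸V)⧸(W⧸V), M^V))` to the class inflated (to `W`, from its layer `V ∩ W = V`)
from -w6 g9's FINITE Shapiro image `shapiroFun y ∈ Hⁿ(W⧸V, M^V)`, transported along
`W⧸(V∩W) ≃ W⧸V`:

  `ev₁_* (Res_W (Inf^Γ_V (iso⁻¹ y))) = Inf^W_{V∩W} (Hⁿ(κ, λ) (shapiroFun y))`    (`extRes_inflG_shapiroFun`).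

With `ContinuousShapiroOpenCoinducedLayerModule.coindOpenHRep_layer_conj` (the `Δ`-action on such
representatives is `Hⁿ(rTrans)`, read by `shapiroFun` as `conjRepCohomology`) this is the complete
finite-layer dictionary for the right-action `Δ`-module `Hⁿ_cont(Γ, Maps(Δ, M))` of lane «TATE-EPC-TC»
(cell `bsd-eis`, crux `GoodLatticeBDPValue`, stmt-BirchSwinnertonDyer-19032; piece (θ-i)-top, layer half,
part 3).  HONEST FRAMING: homological algebra only.

## References
* J.-P. Serre, *Cohomologie galoisienne* (1994), I §2.2 Prop. 8, §2.5 Prop. 10. [SerreGaloisCohomology1997]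
* J. Neukirch, A. Schmidt, K. Wingberg, *Cohomology of Number Fields*, 2nd ed. (2008), I §6
  Prop. (1.6.4)–(1.6.5), (1.5.1). [NeukirchSchmidtWingberg2008]
* K. S. Brown, *Cohomology of Groups* (1982), III §6 (6.2), §8. [Brown1982CohomologyGroups]
-/

noncomputable section

namespace Literature.NumberTheory.GaloisRepresentations

namespace ContinuousRep

open CategoryTheory CategoryTheory.Limits CategoryTheory.Abelian Literature.Algebra.Homology
  Literature.Algebra.Homology.DiscreteRep
  Literature.Algebra.Homology.DiscreteRep.LayerColimit Literature.Algebra.Homology.PermutationDual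
  Literature.Algebra.Homology.QuotientMaps
open _root_.TopRep _root_.ContRepresentation _root_.ContinuousCohomology

variable {G : Type} [Group G] [TopologicalSpace G] [IsTopologicalGroup G] [CompactSpace G]
variable {M : Type} [AddCommGroup M] [TopologicalSpace M] [DiscreteTopology M]
variable (ρ : ContinuousRep G ℤ M) (W : Subgroup G) [W.Normal] (hW : IsOpen (W : Set G))
variable (V : OpenNormalSubgroup G) (hVW : (V : Subgroup G) ≤ W)
variable (hD : DiscreteTopology (ρ.coindOpen W hW).toTopRep.V) [CompactSpace W]

/-! ### §1. The evaluation at `1` on `Maps(Γ⧸W, M)|_W` and the group map `W⧸(V∩W) →* W⧸V` -/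

/-- **`ev₁ : Maps(Γ⧸W, M)|_W ⟶ M|_W`, `φ ↦ φ(1)`** — a morphism of topological `W`-modules (for `w ∈ W`,
`(w ⋆ φ)(1) = w • φ(w⁻¹ W) = w • φ(1)`). [cite: SerreGaloisCohomology1997, I §2.5 Prop. 10] -/
def coindOpenEvalOne : resTop W (ρ.coindOpen W hW).toTopRep ⟶ resTop W ρ.toTopRep :=
  TopRep.ofHom
    { toLinearMap :=
        { toFun := fun φ => φ (1 : G ⧸ W)
          map_add' := fun _ _ => rfl
          map_smul' := fun _ _ => rfl }
      cont := _root_.continuous_apply _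
      isIntertwining' := fun w => by
        ext φ
        change (ρ.coindOpen W hW) (w : G) φ 1 = ρ (w : G) (φ 1)
        have h1 : (w : G)⁻¹ • (1 : G ⧸ W) = 1 := by
          rw [← QuotientGroup.mk_one, MulAction.Quotient.smul_coe, smul_eq_mul, mul_one, QuotientGroup.eq,
            inv_inv, mul_one]
          exact w.2
        rw [coindOpen_apply_apply, h1] }

omit [CompactSpace W] in
/-- Formula. [cite: SerreGaloisCohomology1997, I §2.5 Prop. 10] -/
@[simp] theorem coindOpenEvalOne_apply (φ : G ⧸ W → M) :
    (ρ.coindOpenEvalOne W hW).hom φ = φ (1 : G ⧸ W) := rfl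

/-- **`κ : W ⧸ (V ∩ W) →* ↥(W⧸V)`** (`W⧸V = W.map (mk' V) ≤ Γ⧸V`), `[w] ↦ ⟨[w], _⟩`; composed with the
inclusion it is door-c4's `traceQuotMap W V`. [cite: SerreGaloisCohomology1997, I §2.2 Prop. 8] -/
def traceQuotMapRange :
    W ⧸ (traceOpenNormalSubgroup W V : Subgroup W) →* W.map (QuotientGroup.mk' (V : Subgroup G)) :=
  (traceQuotMap W V).codRestrict _ fun q => by
    induction q using QuotientGroup.induction_on with
    | H w => exact ⟨w, w.2, rfl⟩

omit [IsTopologicalGroup G] [CompactSpace G] [W.Normal] [CompactSpace W] in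
/-- `subtype ∘ κ = traceQuotMap`. [cite: SerreGaloisCohomology1997, I §2.2 Prop. 8] -/
theorem subtype_comp_traceQuotMapRange :
    (W.map (QuotientGroup.mk' (V : Subgroup G))).subtype.comp (traceQuotMapRange W V) = traceQuotMap W V :=
  MonoidHom.ext fun _ => rfl

/-- **`λ : Res_κ (Res_{W⧸V} M^V) ⟶ (Res_W M)^{V∩W}`**, the identity on vectors (a `V`-invariant vector of
`M` is `V ∩ W`-invariant). [cite: SerreGaloisCohomology1997, I §2.2 Prop. 8] -/
def traceLayerHomRange :
    Rep.res (traceQuotMapRange W V)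
        (_root_.Literature.Algebra.Homology.resSub (W.map (QuotientGroup.mk' (V : Subgroup G)))
          ((invariantsQuotFunctor ℤ (V : Subgroup G)).obj (stdBase ρ.toTopRep ρ.isDiscrete_self))) ⟶
      (invariantsQuotFunctor ℤ (traceOpenNormalSubgroup W V : Subgroup W)).obj
        ((resD ℤ W).obj (stdBase ρ.toTopRep ρ.isDiscrete_self)) :=
  Rep.ofHom
    ⟨{ toFun := fun x => ⟨x.1, mem_invariants_traceLayer W V _ x.1 x.2⟩
       map_add' := fun _ _ => rfl
       map_smul' := fun _ _ => rfl },
     fun q => QuotientGroup.induction_on q fun _ => LinearMap.ext fun _ => Subtype.ext rfl⟩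

/-! ### §2. Shapiro on layer representatives, `Ext` level -/

/-- **`ev₁_* (Res_W (Inf^Γ_V (iso⁻¹ y))) = Inf^W_{V∩W} (Hⁿ(κ, λ) (shapiroFun y))`**: door-c4's restriction
`extRes W` to the open subgroup `W` followed by `ev₁`, applied to the class inflated from a `funRep`-layer
class `y`, is the inflation to `W` (from the trace layer `V ∩ W`) of -w6 g9's finite Shapiro image
`shapiroFun y ∈ Hⁿ(W⧸V, M^V)` transported along `κ`, `λ`.
[cite: SerreGaloisCohomology1997, I §2.2 Prop. 8, §2.5 Prop. 10] [cite: Brown1982CohomologyGroups, III §6 (6.2)] -/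
theorem extRes_inflG_shapiroFun [PreservesFiniteLimits (resD ℤ W)] [PreservesFiniteColimits (resD ℤ W)]
    (n : ℕ)
    (y : groupCohomology (funRep ((invariantsQuotFunctor ℤ (V : Subgroup G)).obj
      (stdBase ρ.toTopRep ρ.isDiscrete_self))
        ((G ⧸ (V : Subgroup G)) ⧸ W.map (QuotientGroup.mk' (V : Subgroup G)))) n) :
    (extRes W (triv (Γ := G) ℤ) _ n
        (inflG V (stdBase (ρ.coindOpen W hW).toTopRep (ρ.isDiscrete_coindOpen W hW)) n
          ((groupCohomology.map (MonoidHom.id _) (ρ.coindOpenLayerIso W hW V hVW hD).inv n).hom y))).comp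
        (Ext.mk₀ (stdBaseMap (isDiscrete_resTop W (ρ.isDiscrete_coindOpen W hW))
          (isDiscrete_resTop W ρ.isDiscrete_self) (ρ.coindOpenEvalOne W hW))) (add_zero n) =
      inflG (traceOpenNormalSubgroup W V) (stdBase (resTop W ρ.toTopRep) (isDiscrete_resTop W ρ.isDiscrete_self)) n
        ((groupCohomology.map (traceQuotMapRange W V) (ρ.traceLayerHomRange W V) n).hom
          ((QuotientMaps.shapiroFun (W.map (QuotientGroup.mk' (V : Subgroup G))) _ n).hom y)) := by
  -- restriction read on layers (door-c4), then `ev₁` read on layers (`inflG_map`)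
  erw [extRes_inflG W V (stdBase (ρ.coindOpen W hW).toTopRep (ρ.isDiscrete_coindOpen W hW)) n]
  refine (inflG_map (traceOpenNormalSubgroup W V)
    (M := (resD ℤ W).obj (stdBase (ρ.coindOpen W hW).toTopRep (ρ.isDiscrete_coindOpen W hW)))
    (M' := stdBase (resTop W ρ.toTopRep) (isDiscrete_resTop W ρ.isDiscrete_self))
    (stdBaseMap (isDiscrete_resTop W (ρ.isDiscrete_coindOpen W hW))
      (isDiscrete_resTop W ρ.isDiscrete_self) (ρ.coindOpenEvalOne W hW)) n _).symm.trans ?_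
  congr 1
  -- the two layer classes: both are `Hⁿ(traceQuotMap, ψ ↦ ψ(1))` of `y`
  have key :
      groupCohomology.map (MonoidHom.id _) (ρ.coindOpenLayerIso W hW V hVW hD).inv n ≫
        groupCohomology.map (traceQuotMap W V)
          (traceLayerHom W V (stdBase (ρ.coindOpen W hW).toTopRep (ρ.isDiscrete_coindOpen W hW))) n ≫
        groupCohomology.map (MonoidHom.id _)
          ((invariantsQuotFunctor ℤ (traceOpenNormalSubgroup W V : Subgroup W)).map
            (stdBaseMap (isDiscrete_resTop W (ρ.isDiscrete_coindOpen W hW))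
              (isDiscrete_resTop W ρ.isDiscrete_self) (ρ.coindOpenEvalOne W hW) :
              (resD ℤ W).obj (stdBase (ρ.coindOpen W hW).toTopRep (ρ.isDiscrete_coindOpen W hW)) ⟶ _)) n =
      QuotientMaps.shapiroFun (W.map (QuotientGroup.mk' (V : Subgroup G))) _ n ≫
        groupCohomology.map (traceQuotMapRange W V) (ρ.traceLayerHomRange W V) n := by
    rw [QuotientMaps.shapiroFun, Category.assoc, ← groupCohomology.map_comp, ← groupCohomology.map_comp,
      ← groupCohomology.map_comp, ← groupCohomology.map_comp]
    refine map_congr' ?_ _ _ (fun ψ => ?_) n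
    · exact MonoidHom.ext fun q => QuotientGroup.induction_on q fun w => rfl
    · apply Subtype.ext
      have h1 : ((ρ.coindOpenLayerIso W hW V hVW hD).inv.hom ψ).1 (1 : G ⧸ W) = (ψ 1).1 := by
        show (ψ ((QuotientGroup.quotientQuotientEquivQuotient (V : Subgroup G) W hVW).symm 1)).1 = (ψ 1).1
        rw [map_one]
      have h2 : (((funRepIsoCoindSub (W.map (QuotientGroup.mk' (V : Subgroup G)))
          ((invariantsQuotFunctor ℤ (V : Subgroup G)).obj (stdBase ρ.toTopRep ρ.isDiscrete_self))).hom.hom ψ).1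
            1).1 = (ψ 1).1 := by
        rw [funRepIsoCoindSub_hom_apply_coe, inv_one, map_one, Module.End.one_apply]
        rfl
      exact h1.trans h2.symm
  have hkey := congrArg (fun φ => (ModuleCat.Hom.hom φ) y) key
  simp only [ModuleCat.hom_comp, LinearMap.comp_apply] at hkey
  exact hkey

end ContinuousRep

end Literature.NumberTheory.GaloisRepresentations

end
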